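import Summits.PneNP.PneNP.Theorems.PeaTwoMemBPP.Negative.QuadraticCharSums

/-!
# PneNP / SzkEntropy — crux `PeaTwoMemBPP` (stmt-PneNP-10778), negative side: no `ξ`-independent quadratic encoding of a cubic monomial — hence no entropy-exact local quadratic gadget `PEA₃ → PEA₂`

Route `PneNP/SzkEntropy`, crux stmt-PneNP-10778 (`PEA 2 ∈ PromiseBPP'`).  Author: the crux's standing
disprover (refuter-cdisprove, cycle 2).  Context: `RenyiAndSignedDegreeReduction.lean` (§6 of the crux's
`Disproof.lean`) removes one cubic monomial by EIGHT quadratic maps with SIGNED coefficients; a single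
quadratic gadget with `H(gadget(p)) = H(p) + c` for every cubic `p` would be a local Karp reduction
`PEA₃ ≤ PEA₂` and make the crux equivalent to the kill switch `PeaThreeMemBPP` (= `SZK_L ⊆ BPP`).
`Disproof.lean` §10 (THEOREM 10.1, seven test maps + ℚ-independence of `log₂3, log₂5, log₂7`) reduces the
existence of such a gadget — replace `μ = x_a x_b x_c` by a quadratic `A(ξ, w)` (`ξ = (x_a,x_b,x_c)`,
`w ∈ F₂ˢ` fresh) and append quadratic outputs `B(ξ, w) ∈ F₂ᵗ` — to the algebraic statement refuted here:

**Theorem (`no_xi_independent_quadratic_encoding`).**  There are no `B : F₂³ × F₂ˢ → F₂ᵗ`,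
`Q : F₂³ × F₂ˢ → F₂`, `c : F₂ᵗ → F₂` such that `Q` and every `F₂`-linear combination `u·B` have
degree `≤ 2` (all third derivatives vanish), the law of `B(ξ, U)` does not depend on `ξ` (every fibre
`{B = b}` meets every `ξ`-slice in exactly one eighth of its points), and `x_a x_b x_c + Q = c ∘ B`.

Proof ("3 does not divide a power of 2").  On a fibre `V_b = {B = b}` the encoding gives `Q = μ + c(b)`,
and equidistribution over the `ξ`-slices gives `8·Σ_{V_b} (−1)^Q = (−1)^{c(b)}·|V_b|·Σ_{ξ}(−1)^{μ(ξ)} =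
6·(−1)^{c(b)}|V_b|`, and likewise `8·Σ_{V_b}(−1)^{Q + ξ_a} = 2·(−1)^{c(b)}|V_b|` (`sum_sgn_cube`,
`sum_sgn_cube'`).  Summing against the character `(−1)^{u·b}` of `F₂ᵗ` yields, for `f_u := Q + u·B`,
`8·S(f_u) = 6·K_u` and `8·S(f_u + ξ_a) = 2·K_u` with `S` the character sum over `F₂³ × F₂ˢ` and
`K_u = Σ_b (−1)^{u·b + c(b)} |V_b| ∈ ℤ`; so `S(f_u) = 3·S(f_u + ξ_a)`.  But `f_u` and `f_u + ξ_a` are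
degree-`≤ 2` functions with the SAME radical `R` (directions of constant derivative), and for such `f`,
`S(f)² ∈ {0, |G|·|R|}` (`charSum_sq_dichotomy`: `S² = Σ_a S(D_a f)`, a non-constant affine derivative
sums to `0`, and on `R` the map `a ↦ f(a) + f(0)` is additive); `S(f_u)² = 9·S(f_u + ξ_a)²` then forces
both to vanish, so `K_u = 0` for every `u`, and Fourier inversion on `F₂ᵗ` gives `|V_b| = 0` for all `b` —
absurd, `0 ∈ V_{B(0)}`.  Everything is finite sums over `F₂`-vector spaces; no classification of quadratic
forms is used.

Consequence (with `Disproof.lean` THEOREM 10.1): **no entropy-exact local quadratic gadget for a cubic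
monomial exists, for any number of fresh variables and outputs** — the signs in the eight-term identity
of `RenyiAndSignedDegreeReduction.lean` are unavoidable, and a Karp reduction `PEA₃ ≤ PEA₂`, if one exists
at all, cannot be assembled monomial by monomial.

References: Z. Dvir, D. Gutfreund, G. N. Rothblum, S. Vadhan, *On approximating the entropy of polynomial
mappings*, ICS 2011 (ECCC TR10-160), Thm 4.5–4.7 (degree-3 encodings); Y. Ishai, E. Kushilevitz,
*Randomizing polynomials*, FOCS 2000, §5 (degree of randomizing polynomials); F. J. MacWilliams,
N. J. A. Sloane, *The Theory of Error-Correcting Codes*, Ch. 15 §2 (character sums of quadratic Boolean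
functions; only the elementary squaring argument is used here).
-/

namespace Summit.PneNP.PneNP.Theorems.PeaTwoMemBPP.Negative

open Finset


/-! ### The cubic monomial on `F₂³ × F₂ˢ` -/

/-- The cubic monomial `μ(ξ) = ξ₀ξ₁ξ₂`. [DvirGutfreundRothblumVadhan2010, §3] -/
def cube (ξ : Fin 3 → ZMod 2) : ZMod 2 := ξ 0 * ξ 1 * ξ 2

/-- `F₂`-dot product on `F₂ᵗ`. [folklore] -/
def dot {t : ℕ} (u v : Fin t → ZMod 2) : ZMod 2 := ∑ i, u i * v i

/-- `dot` is additive in the second argument. [folklore] -/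
theorem dot_add {t : ℕ} (u v v' : Fin t → ZMod 2) : dot u (v + v') = dot u v + dot u v' := by
  unfold dot
  rw [← Finset.sum_add_distrib]
  refine Finset.sum_congr rfl fun i _ => ?_
  rw [Pi.add_apply, mul_add]

/-- `dot` is additive in the first argument. [folklore] -/
theorem add_dot {t : ℕ} (u u' v : Fin t → ZMod 2) : dot (u + u') v = dot u v + dot u' v := by
  unfold dot
  rw [← Finset.sum_add_distrib]
  refine Finset.sum_congr rfl fun i _ => ?_
  rw [Pi.add_apply, add_mul]

/-- `dot u 0 = 0`. [folklore] -/
theorem dot_zero {t : ℕ} (u : Fin t → ZMod 2) : dot u 0 = 0 := by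
  unfold dot; simp

/-- `dot 0 v = 0`. [folklore] -/
theorem zero_dot {t : ℕ} (v : Fin t → ZMod 2) : dot 0 v = 0 := by
  unfold dot; simp

/-- `dot (single i 1) d = d i`. [folklore] -/
theorem dot_single {t : ℕ} (i : Fin t) (d : Fin t → ZMod 2) : dot (Pi.single i 1) d = d i := by
  unfold dot
  rw [Finset.sum_eq_single i]
  · simp
  · intro j _ hj; simp [Pi.single_eq_of_ne hj]
  · intro h; exact absurd (Finset.mem_univ i) h

/-- **Character orthogonality on `F₂ᵗ`**: `Σ_u (−1)^{u·d} = 0` for `d ≠ 0`. [LidlNiederreiter1997, Ch. 5] -/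
theorem sum_sgn_dot_eq_zero {t : ℕ} {d : Fin t → ZMod 2} (hd : d ≠ 0) :
    ∑ u : Fin t → ZMod 2, sgn (dot u d) = 0 := by
  obtain ⟨i, hi⟩ : ∃ i, d i ≠ 0 := by
    by_contra h; push Not at h; exact hd (funext h)
  have hdeg : IsDeg1 (fun u : Fin t → ZMod 2 => dot u d) := by
    intro x a b
    simp only [add_dot]
    ring_nf
    reduce_mod_char
  have hne : (fun u : Fin t → ZMod 2 => dot u d) (Pi.single i 1) ≠ (fun u => dot u d) 0 := by
    simp only [dot_single, zero_dot]
    exact hi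
  exact charSum_eq_zero_of_deg1 hdeg hne

/-- `Σ_u (−1)^{u·0} = 2ᵗ`. [LidlNiederreiter1997, Ch. 5] -/
theorem sum_sgn_dot_zero (t : ℕ) : ∑ u : Fin t → ZMod 2, sgn (dot u 0) = 2 ^ t := by
  simp only [dot_zero, sgn_zero, Finset.sum_const, Finset.card_univ, nsmul_eq_mul, mul_one]
  rw [Fintype.card_fun, ZMod.card, Fintype.card_fin]
  simp

/-- `v + v = 0` in `F₂ᵗ`. [folklore] -/
theorem add_self_pi {t : ℕ} (v : Fin t → ZMod 2) : v + v = 0 := by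
  funext i
  show v i + v i = 0
  generalize v i = p; revert p; decide

/-- **Fourier inversion on `F₂ᵗ`**: if all character sums of `g` vanish, `g = 0`. [LidlNiederreiter1997, Ch. 5] -/
theorem eq_zero_of_fourier_zero {t : ℕ} (g : (Fin t → ZMod 2) → ℤ)
    (h : ∀ u : Fin t → ZMod 2, ∑ b, sgn (dot u b) * g b = 0) (b₀ : Fin t → ZMod 2) : g b₀ = 0 := by
  have inner : ∀ b : Fin t → ZMod 2, ∑ u : Fin t → ZMod 2, sgn (dot u (b₀ + b)) * g b =
      if b = b₀ then 2 ^ t * g b₀ else 0 := fun b => by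
    rw [← Finset.sum_mul]
    by_cases hb : b = b₀
    · rw [if_pos hb, hb, add_self_pi, sum_sgn_dot_zero]
    · rw [if_neg hb]
      have hne : b₀ + b ≠ 0 := by
        intro h0
        apply hb
        have : b = b₀ + b + b₀ := by
          rw [add_comm b₀ b, add_assoc, add_self_pi, add_zero]
        rw [this, h0, zero_add]
      rw [sum_sgn_dot_eq_zero hne, zero_mul]
  have key : ∑ u : Fin t → ZMod 2, sgn (dot u b₀) * ∑ b, sgn (dot u b) * g b = 2 ^ t * g b₀ := by
    have e1 : ∀ u : Fin t → ZMod 2, sgn (dot u b₀) * ∑ b, sgn (dot u b) * g b =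
        ∑ b, sgn (dot u (b₀ + b)) * g b := fun u => by
      rw [Finset.mul_sum]
      refine Finset.sum_congr rfl fun b _ => ?_
      rw [dot_add, sgn_add]; ring
    rw [Finset.sum_congr rfl fun u _ => e1 u, Finset.sum_comm,
      Finset.sum_congr rfl fun b _ => inner b, Finset.sum_ite_eq' Finset.univ b₀,
      if_pos (Finset.mem_univ _)]
  have h0 : ∑ u : Fin t → ZMod 2, sgn (dot u b₀) * ∑ b, sgn (dot u b) * g b = 0 :=
    Finset.sum_eq_zero fun u _ => by rw [h u, mul_zero]
  rw [h0] at key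
  have h2 : (2 : ℤ) ^ t ≠ 0 := pow_ne_zero _ two_ne_zero
  exact (mul_eq_zero.1 key.symm).resolve_left h2

/-- `Σ_ξ (−1)^{ξ₀ξ₁ξ₂} = 6` (the monomial has weight 1 on the 8-point cube). [folklore] -/
theorem sum_sgn_cube : ∑ ξ : Fin 3 → ZMod 2, sgn (cube ξ) = 6 := by
  unfold cube sgn; decide

/-- `Σ_ξ (−1)^{ξ₀ξ₁ξ₂ + ξ₀} = 2`. [folklore] -/
theorem sum_sgn_cube' : ∑ ξ : Fin 3 → ZMod 2, sgn (cube ξ + ξ 0) = 2 := by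
  unfold cube sgn; decide

/-- The first coordinate `x ↦ ξ₀(x)` as an additive map on `F₂³ × F₂ˢ`. [folklore] -/
def xi0 (s : ℕ) : ((Fin 3 → ZMod 2) × (Fin s → ZMod 2)) →+ ZMod 2 where
  toFun x := x.1 0
  map_zero' := rfl
  map_add' _ _ := rfl

/-- `xi0 s x = x.1 0`. [folklore] -/
theorem xi0_apply {s : ℕ} (x : ((Fin 3 → ZMod 2) × (Fin s → ZMod 2))) : xi0 s x = x.1 0 := rfl

/-- `x + x = 0` in `F₂³ × F₂ˢ`. [folklore] -/
theorem add_self_G3 {s : ℕ} (x : ((Fin 3 → ZMod 2) × (Fin s → ZMod 2))) : x + x = 0 :=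
  Prod.ext (add_self_pi x.1) (add_self_pi x.2)

/-! ### Equidistributed fibres -/

section Fibres

variable {s t : ℕ} (B : ((Fin 3 → ZMod 2) × (Fin s → ZMod 2)) → (Fin t → ZMod 2))

/-- The fibre `V_b = {x : B x = b}`. -/
def fib (b : Fin t → ZMod 2) : Finset (((Fin 3 → ZMod 2) × (Fin s → ZMod 2))) := univ.filter fun x => B x = b

/-- **Averaging a function of `ξ` over an equidistributed fibre**: `8·Σ_{V_b} φ(ξ) = |V_b|·Σ_ξ φ(ξ)`.
[folklore] -/
theorem sum_fib_of_equidistributed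
    (hind : ∀ (b : Fin t → ZMod 2) (ξ₀ : Fin 3 → ZMod 2),
      8 * ((fib B b).filter fun x => x.1 = ξ₀).card = (fib B b).card)
    (φ : (Fin 3 → ZMod 2) → ℤ) (b : Fin t → ZMod 2) :
    8 * ∑ x ∈ fib B b, φ x.1 = (fib B b).card * ∑ ξ₀, φ ξ₀ := by
  have split : ∑ x ∈ fib B b, φ x.1 = ∑ ξ₀, ∑ x ∈ (fib B b).filter (fun x => x.1 = ξ₀), φ x.1 :=
    (Finset.sum_fiberwise (fib B b) (fun x : ((Fin 3 → ZMod 2) × (Fin s → ZMod 2)) => x.1) (fun x => φ x.1)).symm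
  have inner : ∀ ξ₀ : Fin 3 → ZMod 2, ∑ x ∈ (fib B b).filter (fun x => x.1 = ξ₀), φ x.1 =
      ((fib B b).filter fun x => x.1 = ξ₀).card * φ ξ₀ := fun ξ₀ => by
    rw [Finset.sum_congr rfl fun x hx => by rw [(Finset.mem_filter.1 hx).2], Finset.sum_const,
      nsmul_eq_mul]
  rw [split, Finset.sum_congr rfl fun ξ₀ _ => inner ξ₀]
  conv_lhs => rw [Finset.mul_sum]
  conv_rhs => rw [Finset.mul_sum]
  refine Finset.sum_congr rfl fun ξ₀ _ => ?_
  have h := hind b ξ₀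
  have h' : (8 : ℤ) * ((fib B b).filter fun x => x.1 = ξ₀).card = (fib B b).card := by
    exact_mod_cast h
  rw [← mul_assoc, h']

end Fibres

/-! ### The theorem -/

/-- **No `ξ`-independent quadratic encoding of a cubic monomial.**  There are no maps
`B : F₂³ × F₂ˢ → F₂ᵗ`, `Q : F₂³ × F₂ˢ → F₂`, `c : F₂ᵗ → F₂` with `Q` and every `u·B` of degree `≤ 2`,
every fibre of `B` equidistributed over the eight `ξ`-slices (`B(ξ,U)` independent of `ξ`), and
`ξ₀ξ₁ξ₂ + Q = c ∘ B`.  With `Disproof.lean` THEOREM 10.1 this rules out every entropy-exact local quadratic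
gadget replacing a cubic monomial (any number `s` of fresh variables and `t` of fresh outputs), hence every
gadget-local Karp reduction `PEA₃ ≤ PEA₂`. -/
theorem no_xi_independent_quadratic_encoding (s t : ℕ)
    (B : ((Fin 3 → ZMod 2) × (Fin s → ZMod 2)) → (Fin t → ZMod 2)) (Q : ((Fin 3 → ZMod 2) × (Fin s → ZMod 2)) → ZMod 2) (c : (Fin t → ZMod 2) → ZMod 2)
    (hQ : IsDeg2 Q) (hB : ∀ u : Fin t → ZMod 2, IsDeg2 (fun x => dot u (B x)))
    (hind : ∀ (b : Fin t → ZMod 2) (ξ₀ : Fin 3 → ZMod 2),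
      8 * ((fib B b).filter fun x => x.1 = ξ₀).card = (fib B b).card)
    (henc : ∀ x : ((Fin 3 → ZMod 2) × (Fin s → ZMod 2)), cube x.1 + Q x = c (B x)) : False := by
  -- Step 1: fibre sums of (−1)^Q and (−1)^{Q + ξ₀}
  have hQfib : ∀ b, ∀ x ∈ fib B b, sgn (Q x) = sgn (c b) * sgn (cube x.1) := by
    intro b x hx
    have hb : B x = b := (Finset.mem_filter.1 hx).2
    have hx' : Q x = c b + cube x.1 := by
      have h := henc x
      rw [hb] at h
      linear_combination (norm := ring_nf) h
      all_goals reduce_mod_char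
    rw [hx', sgn_add]
  have step1 : ∀ b, 8 * ∑ x ∈ fib B b, sgn (Q x) = 6 * (sgn (c b) * (fib B b).card) := by
    intro b
    have e1 : ∑ x ∈ fib B b, sgn (Q x) = sgn (c b) * ∑ x ∈ fib B b, sgn (cube x.1) := by
      rw [Finset.mul_sum]; exact Finset.sum_congr rfl (hQfib b)
    have key := sum_fib_of_equidistributed B hind (fun ξ => sgn (cube ξ)) b
    simp only [sum_sgn_cube] at key
    rw [e1]
    linear_combination sgn (c b) * key
  have step1' : ∀ b, 8 * ∑ x ∈ fib B b, sgn (Q x + x.1 0) = 2 * (sgn (c b) * (fib B b).card) := by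
    intro b
    have e1 : ∑ x ∈ fib B b, sgn (Q x + x.1 0) = sgn (c b) * ∑ x ∈ fib B b, sgn (cube x.1 + x.1 0) := by
      rw [Finset.mul_sum]
      refine Finset.sum_congr rfl fun x hx => ?_
      rw [sgn_add, hQfib b x hx, sgn_add]; ring
    have key := sum_fib_of_equidistributed B hind (fun ξ => sgn (cube ξ + ξ 0)) b
    simp only [sum_sgn_cube'] at key
    rw [e1]
    linear_combination sgn (c b) * key
  -- Step 2: character sums of f_u := Q + u·B and f_u + ξ₀, regrouped by the fibres of B
  have step2 : ∀ u : Fin t → ZMod 2,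
      8 * charSum (fun x => Q x + dot u (B x)) = 6 * ∑ b, sgn (dot u b) * (sgn (c b) * (fib B b).card) := by
    intro u
    have inner : ∀ b : Fin t → ZMod 2,
        ∑ x ∈ Finset.univ.filter (fun x : ((Fin 3 → ZMod 2) × (Fin s → ZMod 2)) => B x = b), sgn (Q x + dot u (B x)) =
          sgn (dot u b) * ∑ x ∈ fib B b, sgn (Q x) := fun b => by
      rw [Finset.mul_sum]
      refine Finset.sum_congr rfl fun x hx => ?_
      rw [(Finset.mem_filter.1 hx).2, sgn_add, mul_comm]
    calc 8 * charSum (fun x => Q x + dot u (B x))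
        = 8 * ∑ b, ∑ x ∈ Finset.univ.filter (fun x : ((Fin 3 → ZMod 2) × (Fin s → ZMod 2)) => B x = b), sgn (Q x + dot u (B x)) := by
          unfold charSum
          rw [Finset.sum_fiberwise Finset.univ B (fun x => sgn (Q x + dot u (B x)))]
      _ = 8 * ∑ b, sgn (dot u b) * ∑ x ∈ fib B b, sgn (Q x) := by
          rw [Finset.sum_congr rfl fun b _ => inner b]
      _ = ∑ b, sgn (dot u b) * (8 * ∑ x ∈ fib B b, sgn (Q x)) := by
          rw [Finset.mul_sum]
          refine Finset.sum_congr rfl fun b _ => ?_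
          ring
      _ = ∑ b, sgn (dot u b) * (6 * (sgn (c b) * (fib B b).card)) := by
          refine Finset.sum_congr rfl fun b _ => ?_
          rw [step1 b]
      _ = 6 * ∑ b, sgn (dot u b) * (sgn (c b) * (fib B b).card) := by
          rw [Finset.mul_sum]
          refine Finset.sum_congr rfl fun b _ => ?_
          ring
  have step2' : ∀ u : Fin t → ZMod 2,
      8 * charSum (fun x => (Q x + dot u (B x)) + xi0 s x) =
        2 * ∑ b, sgn (dot u b) * (sgn (c b) * (fib B b).card) := by
    intro u
    have inner : ∀ b : Fin t → ZMod 2,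
        ∑ x ∈ Finset.univ.filter (fun x : ((Fin 3 → ZMod 2) × (Fin s → ZMod 2)) => B x = b), sgn ((Q x + dot u (B x)) + xi0 s x) =
          sgn (dot u b) * ∑ x ∈ fib B b, sgn (Q x + x.1 0) := fun b => by
      rw [Finset.mul_sum]
      refine Finset.sum_congr rfl fun x hx => ?_
      rw [(Finset.mem_filter.1 hx).2, xi0_apply,
        show Q x + dot u b + x.1 0 = (Q x + x.1 0) + dot u b by ring, sgn_add, mul_comm]
    calc 8 * charSum (fun x => (Q x + dot u (B x)) + xi0 s x)
        = 8 * ∑ b, ∑ x ∈ Finset.univ.filter (fun x : ((Fin 3 → ZMod 2) × (Fin s → ZMod 2)) => B x = b),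
            sgn ((Q x + dot u (B x)) + xi0 s x) := by
          unfold charSum
          rw [Finset.sum_fiberwise Finset.univ B (fun x => sgn ((Q x + dot u (B x)) + xi0 s x))]
      _ = 8 * ∑ b, sgn (dot u b) * ∑ x ∈ fib B b, sgn (Q x + x.1 0) := by
          rw [Finset.sum_congr rfl fun b _ => inner b]
      _ = ∑ b, sgn (dot u b) * (8 * ∑ x ∈ fib B b, sgn (Q x + x.1 0)) := by
          rw [Finset.mul_sum]
          refine Finset.sum_congr rfl fun b _ => ?_
          ring
      _ = ∑ b, sgn (dot u b) * (2 * (sgn (c b) * (fib B b).card)) := by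
          refine Finset.sum_congr rfl fun b _ => ?_
          rw [step1' b]
      _ = 2 * ∑ b, sgn (dot u b) * (sgn (c b) * (fib B b).card) := by
          rw [Finset.mul_sum]
          refine Finset.sum_congr rfl fun b _ => ?_
          ring
  -- Step 3: S(f_u) = 3 S(f_u + ξ₀), hence 0, hence the Fourier data vanish
  have step3 : ∀ u : Fin t → ZMod 2, ∑ b, sgn (dot u b) * (sgn (c b) * ((fib B b).card : ℤ)) = 0 := by
    intro u
    have hf : IsDeg2 (fun x => Q x + dot u (B x)) := deg2_add hQ (hB u)
    have h3 : charSum (fun x => Q x + dot u (B x)) =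
        3 * charSum (fun x => (Q x + dot u (B x)) + xi0 s x) := by
      have e₁ := step2 u
      have e₂ := step2' u
      linarith
    have h0 := charSum_eq_zero_of_eq_three_mul hf (xi0 s) add_self_G3 h3
    have e₁ := step2 u
    rw [h0, mul_zero] at e₁
    linarith
  -- Step 4: Fourier inversion: every signed fibre size vanishes — but 0 lies in the fibre of B 0
  have h4 := eq_zero_of_fourier_zero (fun b => sgn (c b) * ((fib B b).card : ℤ)) step3 (B 0)
  have hmem : (0 : ((Fin 3 → ZMod 2) × (Fin s → ZMod 2))) ∈ fib B (B 0) := Finset.mem_filter.2 ⟨Finset.mem_univ _, rfl⟩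
  have hcard : 0 < (fib B (B 0)).card := Finset.card_pos.2 ⟨0, hmem⟩
  rcases mul_eq_zero.1 h4 with h | h
  · exact sgn_ne_zero _ h
  · have : (fib B (B 0)).card = 0 := by exact_mod_cast h
    omega

end Summit.PneNP.PneNP.Theorems.PeaTwoMemBPP.Negative
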